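import Summits.Ventures.Crystal3D.Theorems.StickyWulffConstantCoaxialWallLawCanonicalLensType
import Summits.Ventures.Crystal3D.Theorems.StickyWulffConstantCoaxialWallLawDustDecorationLens
import HarnessLib

/-!
# Lens soundness reduced to the frame side: `localSummandA ≤ (typeOf X).row L₀` from `hD` (module coordinates)
# (crux `CoaxialWallLaw`, stmt-Ventures-19481; cf-p1 DECISION (cxi); T4 brick, census-free)

HONEST FRAMING. Venture `Summits/Ventures/Crystal3D` (cell `crystal3d-full`); helper `--supports` the crux `CoaxialWallLaw`
(stmt-Ventures-19481, `route-Ventures-StickyWulffConstant`), registered line 'CoaxialWallLawCertificates' (planner cf-p1).  Census-free;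
F-C1 not moved.  Assembles `…CanonicalLensType` (the canonical type `typeOf X` is well formed and realisable) with `…DustDecorationLens`
(the credit-free decoration lemma):
* `localSummandFlatDecL_congr` — the lens functional at `z` depends on the decoration only on exact balls within `2` of `z`;
* `length_filter_toList`, `hostPoint_typeOf`, `looseAt_typeOf_eq_dustDeg` — on exact balls within `2` of the payer the canonical type's
  `looseAt` IS the true dust degree `dustDeg X (exactOf X)`;
* **`localSummandA_le_row_typeOf`** — for `X` in module coordinates and a frame `L₀`: if every (A)-end pair `(b, q)` with `dist 0 b ≤ 1` of
  the systems `(basalSystem L₀, basalSystem (H·L₀))` is a flat end pair of the exact part `exactOf X` (hypothesis `hD`, the frame side), then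
  `localSummandA ≤ (typeOf X).row L₀`;
* **`lens_witness_of_hD`** — hence the second disjunct of `LensSoundness` holds at such a window whenever `StdFrame L₀`.
So `LensSoundness` is reduced to: PLACEMENT (module coordinates from the first reader, `StdFrame` of the frame — `stdFrame_of_isEndMove_of_
readingDirs`) + `hD` (readers near the payer read exact balls only — `position_of_stdFrame`, `apex_contact_host`) + the junction case.
WHAT THIS IS NOT: not `LensSoundness`; F-C1 not moved.
-/

noncomputable section

set_option maxRecDepth 65536

namespace Summit.Ventures.Crystal3D.Theorems

namespace TailResidue

open Summit.Ventures.Crystal3D Finset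
open scoped InnerProductSpace

/-! ### The lens functional depends on the decoration only within `2` of the payer -/

open scoped Classical in
/-- Decorated degrees agree where the decorations agree. -/
theorem degDec_congr {P : Finset (EuclideanSpace ℝ (Fin 3))} {δ δ' : EuclideanSpace ℝ (Fin 3) → ℕ} {y : EuclideanSpace ℝ (Fin 3)}
    (h : δ y = δ' y) : degDec P δ y = degDec P δ' y := by
  unfold degDec; rw [h]

open scoped Classical in
/-- **Decoration congruence**: `localSummandFlatDecL … P δ z` depends on `δ` only on the balls of `P` within `2` of `z`. -/
theorem localSummandFlatDecL_congr {v : WordVersion} {S₁ S₂ : PlateSystem} {P : Finset (EuclideanSpace ℝ (Fin 3))}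
    {δ δ' : EuclideanSpace ℝ (Fin 3) → ℕ} {z : EuclideanSpace ℝ (Fin 3)} (h : ∀ y ∈ P, dist z y ≤ 2 → δ y = δ' y) :
    localSummandFlatDecL v S₁ S₂ P δ z = localSummandFlatDecL v S₁ S₂ P δ' z := by
  unfold localSummandFlatDecL
  refine sum_congr rfl fun b hb => ?_
  obtain ⟨hbP, hzb, -⟩ := mem_filter.1 hb
  have hdeg : ∀ y ∈ P, dist b y ≤ 1 → degDec P δ y = degDec P δ' y := by
    intro y hy hby
    refine degDec_congr (h y hy ?_)
    calc dist z y ≤ dist z b + dist b y := dist_triangle _ _ _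
      _ ≤ 1 + 1 := add_le_add hzb hby
      _ = 2 := by norm_num
  have hpool : pooledDefFlatDecL P δ b = pooledDefFlatDecL P δ' b := by
    unfold pooledDefFlatDecL
    have hf : P.filter (fun y => dist b y ≤ 1 ∧ degDec P δ y ≤ 11) = P.filter (fun y => dist b y ≤ 1 ∧ degDec P δ' y ≤ 11) := by
      refine filter_congr fun y hy => ?_
      constructor
      · rintro ⟨hd, hdg⟩; exact ⟨hd, by rwa [← hdeg y hy hd]⟩
      · rintro ⟨hd, hdg⟩; exact ⟨hd, by rwa [hdeg y hy hd]⟩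
    have hs : ∑ y ∈ P.filter (fun y => dist b y ≤ 1 ∧ degDec P δ y ≤ 11), ((12 : ℝ) - (degDec P δ y : ℝ)) =
        ∑ y ∈ P.filter (fun y => dist b y ≤ 1 ∧ degDec P δ' y ≤ 11), ((12 : ℝ) - (degDec P δ' y : ℝ)) := by
      rw [hf]
      refine sum_congr rfl fun y hy => ?_
      obtain ⟨hyP, hd, -⟩ := mem_filter.1 hy
      rw [hdeg y hyP hd]
    have htwo : HasTwoPayersDecL P δ b ↔ HasTwoPayersDecL P δ' b := by
      unfold HasTwoPayersDecL
      rw [hdeg b hbP (by simp)]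
      have hf' : P.filter (fun y => dist b y = 1 ∧ degDec P δ y ≤ 11) = P.filter (fun y => dist b y = 1 ∧ degDec P δ' y ≤ 11) := by
        refine filter_congr fun y hy => ?_
        constructor
        · rintro ⟨hd, hdg⟩; exact ⟨hd, by rwa [← hdeg y hy (le_of_eq hd)]⟩
        · rintro ⟨hd, hdg⟩; exact ⟨hd, by rwa [hdeg y hy (le_of_eq hd)]⟩
      rw [hf']
    rw [hs]
    by_cases ht : HasTwoPayersDecL P δ b
    · rw [if_pos ht, if_pos (htwo.1 ht)]
    · rw [if_neg ht, if_neg (fun h' => ht (htwo.2 h'))]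
  rw [hpool]

/-! ### The canonical decoration is the true dust degree -/

/-- Lists: the length of a filtered `toList` is the cardinality of the filtered `Finset`. -/
theorem length_filter_toList {α : Type*} (s : Finset α) (p : α → Prop) [DecidablePred p] :
    (s.toList.filter fun x => decide (p x)).length = (s.filter p).card := by
  rw [← Finset.length_toList]
  apply List.Perm.length_eq
  rw [List.perm_ext_iff_of_nodup ((Finset.nodup_toList s).filter _) (Finset.nodup_toList _)]
  intro a
  simp [Finset.mem_toList, List.mem_filter]

variable (X : Finset (EuclideanSpace ℝ (Fin 3)))

/-- The canonical type's host points are the reference points. -/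
theorem hostPoint_typeOf : (typeOf X).hostPoint = refPoint := funext (typeOf_hostPoint X)

open scoped Classical in
/-- A host reference within `2` of the payer is NEAR. -/
theorem near_of_norm_le_two {h : HostRefL} (hh : h ∈ hostRefsOf X) (h2 : ‖refPoint h‖ ≤ 2) : h.Near := by
  rcases Finset.mem_union.1 hh with h1 | h1
  · obtain ⟨s, -, rfl⟩ := Finset.mem_image.1 h1
    exact dsq12_le_of_norm_le_two h2
  · obtain ⟨F, -, rfl⟩ := Finset.mem_image.1 h1
    show dotI F F ≤ 648
    have hsq := norm_fineVec_sq F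
    have h4 : ‖fineVec F‖ ^ 2 ≤ 4 := by
      have : ‖fineVec F‖ ≤ 2 := h2
      nlinarith [norm_nonneg (fineVec F)]
    have : (dotI F F : ℝ) ≤ 648 := by rw [hsq] at h4; linarith
    exact_mod_cast this

-- unification around the closed window Finsets (`apexBall`) is expensive here
set_option maxHeartbeats 800000 in
open scoped Classical in
/-- **On exact balls within `2` of the payer, the canonical `looseAt` is the true dust degree.** -/
theorem looseAt_typeOf_eq_dustDeg {y : EuclideanSpace ℝ (Fin 3)} (hy : y ∈ exactOf X) (hy2 : ‖y‖ ≤ 2) :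
    (typeOf X).looseAt y = dustDeg X (exactOf X) y := by
  obtain ⟨h₀, hh₀, hy₀⟩ := exists_ref_of_mem_exactOf X hy
  -- the filter predicate on dust balls is «touches `y`»
  have hpred : ∀ x : EuclideanSpace ℝ (Fin 3), (y ∈ (hostsOf X x).image refPoint) ↔ dist y x = 1 := by
    intro x
    constructor
    · intro hm
      obtain ⟨h, hh, rfl⟩ := Finset.mem_image.1 hm
      rw [dist_comm]; exact (Finset.mem_filter.1 hh).2
    · intro hd
      refine Finset.mem_image.2 ⟨h₀, Finset.mem_filter.2 ⟨hh₀, ?_⟩, hy₀⟩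
      rw [hy₀, dist_comm]; exact hd
  unfold LensType.looseAt dustDeg
  rw [hostPoint_typeOf]
  have hl : (typeOf X).loose = (dustOf X).toList.map (hostsOf X) := rfl
  rw [hl, List.filter_map, List.length_map]
  have hfc : ((dustOf X).toList.filter ((fun H => decide (y ∈ H.image refPoint)) ∘ hostsOf X)) =
      (dustOf X).toList.filter fun x => decide (dist y x = 1) := by
    refine List.filter_congr fun x _ => ?_
    simp only [Function.comp, decide_eq_decide]
    exact hpred x
  rw [hfc, length_filter_toList]
  congr 1
  ext x
  simp only [Finset.mem_filter, Finset.mem_sdiff]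
  constructor
  · rintro ⟨hx, hd⟩
    obtain ⟨hxX, hne, -⟩ := Finset.mem_filter.1 hx
    exact ⟨⟨hxX, hne⟩, hd⟩
  · rintro ⟨⟨hxX, hne⟩, hd⟩
    have hmem : h₀ ∈ hostsOf X x := by
      unfold hostsOf
      rw [Finset.mem_filter]
      exact ⟨hh₀, by rw [hy₀, dist_comm]; exact hd⟩
    have hy2' : ‖refPoint h₀‖ ≤ 2 := hy₀ ▸ hy2
    have hnear : HostRefL.Near h₀ := near_of_norm_le_two X hh₀ hy2'
    have hxD : x ∈ dustOf X := by
      unfold dustOf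
      rw [Finset.mem_filter]
      exact ⟨hxX, hne, h₀, hmem, hnear⟩
    exact ⟨hxD, hd⟩

/-! ### The reduction -/

variable {X}
variable (hX : ∀ p ∈ X, ∀ q ∈ X, p ≠ q → 1 ≤ dist p q) (h0 : (0 : EuclideanSpace ℝ (Fin 3)) ∈ X)

open scoped Classical in
include h0 in
/-- The payer is an exact ball of the window. -/
theorem zero_mem_exactOf : (0 : EuclideanSpace ℝ (Fin 3)) ∈ exactOf X := by
  refine Finset.mem_union_left _ (Finset.mem_image.2 ⟨(0, 0, 0), Finset.mem_filter.2 ⟨mem_siteBall_of_dsq12 (by simp [dsq12]), ?_⟩,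
    modSite_zero⟩)
  rw [modSite_zero]; exact h0

open scoped Classical in
include h0 in
/-- **THE INEQUALITY from the frame side**: if every (A)-end pair near the payer is a flat end pair of the exact part (`hD`), the (A)
summand at the payer is at most the canonical type's row. -/
theorem localSummandA_le_row_typeOf (L₀ : EuclideanSpace ℝ (Fin 3) ≃ₗᵢ[ℝ] EuclideanSpace ℝ (Fin 3))
    (hD : ∀ b q : EuclideanSpace ℝ (Fin 3), dist (0 : EuclideanSpace ℝ (Fin 3)) b ≤ 1 →
      IsEndPairA X WordVersion.v2 (basalSystem L₀)
        (basalSystem (((ℝ ∙ EuclideanSpace.single (2 : Fin 3) (1 : ℝ)).reflection).trans L₀)) b q →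
      IsEndPairFlat (exactOf X) WordVersion.v2 (basalSystem L₀)
        (basalSystem (((ℝ ∙ EuclideanSpace.single (2 : Fin 3) (1 : ℝ)).reflection).trans L₀)) b q) :
    localSummandA WordVersion.v2 (basalSystem L₀)
      (basalSystem (((ℝ ∙ EuclideanSpace.single (2 : Fin 3) (1 : ℝ)).reflection).trans L₀)) X 0 ≤ (typeOf X).row L₀ := by
  have h1 := localSummandA_le_localSummandFlatDecL_of_dust (hsub := exactOf_subset X) (hz := zero_mem_exactOf h0) (hD := hD)
  refine h1.trans (le_of_eq ?_)
  rw [LensType.row, typeOf_realise]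
  refine localSummandFlatDecL_congr fun y hy hzy => ?_
  rw [looseAt_typeOf_eq_dustDeg X hy (by rwa [dist_eq_norm, zero_sub, norm_neg] at hzy)]

open scoped Classical in
include hX h0 in
/-- **THE LENS WITNESS from the frame side** (module coordinates): under `hD` and `StdFrame L₀`, the second disjunct of `LensSoundness`
holds at the payer `0` of `X`. -/
theorem lens_witness_of_hD (hdeg : (X.filter fun q => dist (0 : EuclideanSpace ℝ (Fin 3)) q = 1).card ≤ 11)
    {L₀ : EuclideanSpace ℝ (Fin 3) ≃ₗᵢ[ℝ] EuclideanSpace ℝ (Fin 3)} (hL₀ : StdFrame L₀)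
    (hD : ∀ b q : EuclideanSpace ℝ (Fin 3), dist (0 : EuclideanSpace ℝ (Fin 3)) b ≤ 1 →
      IsEndPairA X WordVersion.v2 (basalSystem L₀)
        (basalSystem (((ℝ ∙ EuclideanSpace.single (2 : Fin 3) (1 : ℝ)).reflection).trans L₀)) b q →
      IsEndPairFlat (exactOf X) WordVersion.v2 (basalSystem L₀)
        (basalSystem (((ℝ ∙ EuclideanSpace.single (2 : Fin 3) (1 : ℝ)).reflection).trans L₀)) b q) :
    ∃ τ : LensType, τ.WellFormed ∧ τ.Realisable ∧
      ∃ L₁ : EuclideanSpace ℝ (Fin 3) ≃ₗᵢ[ℝ] EuclideanSpace ℝ (Fin 3), StdFrame L₁ ∧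
        localSummandA WordVersion.v2 (basalSystem L₀)
          (basalSystem (((ℝ ∙ EuclideanSpace.single (2 : Fin 3) (1 : ℝ)).reflection).trans L₀)) X 0 ≤ τ.row L₁ :=
  ⟨typeOf X, typeOf_wellFormed hX h0 hdeg, typeOf_realisable hX, L₀, hL₀, localSummandA_le_row_typeOf h0 L₀ hD⟩

end TailResidue

end Summit.Ventures.Crystal3D.Theorems

end
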